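import Summits.QuantumFields.YangMills.Theorems.ForcedResponseSkewnessRunningCouplingCeilingUniformSmearPrep
import HarnessLib

/-!
# Crux `RunningCouplingCeiling` (repaired: stmt-QuantumFields-24275), line `pointwise-log-ceiling`: the smearing step,
# UNIFORM over `L¹`-normalised sources in a fixed positive-time ball

Support file (`--supports stmt-QuantumFields-24275`) by the width prover `ym-line-frs-p3` of route `ForcedResponseSkewness`
(lead `ym-line-frs-p1`); sequel of `…RunningCouplingCeilingUniformSmearPrep`.  The planner's repair (route rev 2, 2026-08-28)
restated the crux with a constant `C` UNIFORM over all real Schwartz `v` with `tsupport v ⊆ closedBall p ρ₀` (`ρ₀ < p₀`) and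
`∫|v| ≤ 1`, the thresholds `β₆, Λ₆` being chosen after `v`.  This file proves the matching ANALYSIS half of the line in
exactly that quantifier order:

* `pair_bound` — every pair charged by `θv ⊗ v` at spacing `s = l t` satisfies
  `θv(s x) v(s y) K x y ≤ |θv(s x)| |v(s y)| · M s⁸/log²Λ`, `M = (4C₀⁺ + C₁⁺ log²(4R²))/(2(p₀−ρ₀))⁸`;
* `uniform_smear` — **the smeared ceiling from pointwise kernel bounds, uniformly in the source**: for every
  `C₀ C₁ C₂ n₀ p ρ₀` with `ρ₀ < p 0` there is `C` such that for every real Schwartz `v` with `tsupport v ⊆ closedBall p ρ₀`,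
  `∫|v| ≤ 1`, every `Λ ≥ 2` there are `t₀ > 0`, `Λ₆` with: for all units `0 < t ≤ t₀`, tori `t·L ≥ Λ₆`, kernels `K` with
  `KernelBounds C₀ C₁ C₂ n₀ t L K` and `l ∈ [Λ, 2Λ]`,  `Σ_{x,y ∈ box L} θv(l t x) v(l t y) K x y ≤ C / log²Λ`.
  The two lattice `ℓ¹`-sums `s⁴Σ|θv(s x)|`, `s⁴Σ|v(s y)|` are `≤ ∫|v| + 1 ≤ 2` for `s` small (Riemann sums), which is
  where the `L¹`-normalisation makes the constant source-independent; `C = 4M`.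

With the physics stub in the form «floor ⇒ `KernelBounds C₀ C₁ C₂ n₀ (a β) L (torusCov β L)` for `β ≥ β₀`, `a(β)·L ≥ Λ₀`»
the repaired crux follows exactly as in the lead's composition `RunningCouplingCeiling_of` (thresholds `max`, `a β ≤ t₀`
eventually, `Q2 = Σ θv ⊗ v · torusCov` by `Q2_eq_sum_torusCov`).

Honest label: bookkeeping/analysis for a CONDITIONAL rung line (leaf R2a `BalabanLadder.NT`, itself one binder of the spine);
the physics half (pointwise kernel bounds for the torus covariance of the action densities) is untouched here; nothing in this
file bears on the Yang–Mills mass gap, which is NOT proved by any of this.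
-/

set_option autoImplicit false

noncomputable section

namespace Summit.QuantumFields.YangMills.Cruxes.RunningCouplingCeiling.Pointwise

open Set Metric Filter Topology Finset MeasureTheory
open scoped SchwartzMap
open Literature.MathematicalPhysics.QuantumLattice Literature.Probability.LatticeModels
open Summit.QuantumFields.YangMills.Cruxes.NT.CeilingPrice (tendsto_envelope sum_box_eq_sum_box_of_cover
  tsupport_abs_subset integral_abs_thetaTest)
open Summit.QuantumFields.YangMills.Cruxes.NT.Reference (tsupport_thetaTest_subset_closedBall_zero)

/-- **The per-pair bound.**  For a witness supported in `closedBall p ρ₀`, a kernel with `KernelBounds C₀ C₁ C₂ n₀ t L K`,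
spacing `s = l t` (`Λ ≤ l`, `2 ≤ Λ`) with `s (n₀+1) ≤ p₀ − ρ₀` and a torus with `2R ≤ s·L` (`‖p‖ + ρ₀ ≤ R`, `1 ≤ R`):
every pair satisfies `θv(s x) v(s y) K x y ≤ |θv(s x)| |v(s y)| · M s⁸/log²Λ`,
`M = (4C₀⁺ + C₁⁺ log²(4R²))/(2(p₀−ρ₀))⁸`. [folklore] -/
theorem pair_bound {v : 𝓢(EuclideanSpace ℝ (Fin 4), ℝ)} {p : EuclideanSpace ℝ (Fin 4)} {ρ₀ : ℝ}
    (hv : tsupport (v : EuclideanSpace ℝ (Fin 4) → ℝ) ⊆ closedBall p ρ₀) {C₀ C₁ C₂ : ℝ} {n₀ : ℕ} {t : ℝ}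
    {L : ℕ} {K : (Fin 4 → ℤ) → (Fin 4 → ℤ) → ℝ} (hK : KernelBounds C₀ C₁ C₂ n₀ t L K) {R Λ l s : ℝ}
    (hR1 : 1 ≤ R) (hρR : ‖p‖ + ρ₀ ≤ R) (hΛ : 2 ≤ Λ) (hl1 : Λ ≤ l) (ht : 0 < t) (hs : s = l * t)
    (hsδ : s * ((n₀ : ℝ) + 1) ≤ p 0 - ρ₀) (h2RsL : 2 * R ≤ s * L) {x y : Fin 4 → ℤ}
    (hx : x ∈ box 4 L) (hy : y ∈ box 4 L) :
    thetaTest 4 v (s • siteToE x) * v (s • siteToE y) * K x y ≤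
      |thetaTest 4 v (s • siteToE x)| * |v (s • siteToE y)| *
        ((4 * max C₀ 0 + max C₁ 0 * Real.log (4 * R ^ 2) ^ 2) / (2 * (p 0 - ρ₀)) ^ 8 * s ^ 8 /
          Real.log Λ ^ 2) := by
  have hl0 : 0 < l := by linarith
  have hs0 : 0 < s := by rw [hs]; exact mul_pos hl0 ht
  have hδ : 0 < p 0 - ρ₀ := lt_of_lt_of_le (by positivity) hsδ
  have hM : 0 ≤ (4 * max C₀ 0 + max C₁ 0 * Real.log (4 * R ^ 2) ^ 2) / (2 * (p 0 - ρ₀)) ^ 8 :=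
    div_nonneg (add_nonneg (mul_nonneg (by norm_num) (le_max_right _ _))
      (mul_nonneg (le_max_right _ _) (sq_nonneg _))) (pow_nonneg (by linarith) 8)
  have hc : 0 ≤ (4 * max C₀ 0 + max C₁ 0 * Real.log (4 * R ^ 2) ^ 2) / (2 * (p 0 - ρ₀)) ^ 8 * s ^ 8 /
      Real.log Λ ^ 2 := div_nonneg (mul_nonneg hM (pow_nonneg hs0.le 8)) (sq_nonneg _)
  by_cases hzero : thetaTest 4 v (s • siteToE x) * v (s • siteToE y) = 0
  · rw [hzero, zero_mul]
    exact mul_nonneg (mul_nonneg (abs_nonneg _) (abs_nonneg _)) hc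
  obtain ⟨hx0, hy0⟩ := mul_ne_zero_iff.1 hzero
  obtain ⟨hx1, hx2, hy1, hy2, hxR, hyR⟩ := pair_coords hv hx0 hy0
  have hp0 : p 0 ≤ ‖p‖ := by
    have h := PiLp.norm_apply_le p (0 : Fin 4)
    rw [Real.norm_eq_abs] at h
    exact (le_abs_self _).trans h
  have hsplit : s * ((y 0 : ℝ) - x 0) = s * y 0 + -(s * x 0) := by ring
  have hlow : 2 * (p 0 - ρ₀) ≤ s * ((y 0 : ℝ) - x 0) := by rw [hsplit]; linarith
  have hup : s * ((y 0 : ℝ) - x 0) ≤ 2 * R := by rw [hsplit]; linarith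
  obtain ⟨hd1, hd2⟩ := pair_torusDist hs0 hδ hlow hup (hxR.trans hρR) (hyR.trans hρR) h2RsL
  have hd0 : 0 < torusDist L x y := by
    by_contra h
    rw [not_lt] at h
    have hd00 : torusDist L x y = 0 := le_antisymm h (torusDist_nonneg L x y)
    rw [hd00, zero_mul] at hd1
    linarith
  have hdn₀ : (n₀ : ℝ) ≤ torusDist L x y := by
    have h1 : (n₀ : ℝ) * s ≤ torusDist L x y * s := by
      calc (n₀ : ℝ) * s ≤ ((n₀ : ℝ) + 1) * s := mul_le_mul_of_nonneg_right (by linarith) hs0.le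
        _ = s * ((n₀ : ℝ) + 1) := mul_comm _ _
        _ ≤ p 0 - ρ₀ := hsδ
        _ ≤ 2 * (p 0 - ρ₀) := by linarith
        _ ≤ torusDist L x y * s := hd1
    exact le_of_mul_le_mul_right h1 hs0
  obtain ⟨_, hK1, hK0⟩ := hK x hx y hy
  have hKlog := kernel_mul_log_sq_le hR1 hΛ hl1 hs ht hd0 hδ hd1 hd2 (abs_nonneg (K x y)) (hK1 hdn₀) (hK0 hdn₀)
  have hlogΛ : 0 < Real.log Λ := Real.log_pos (by linarith)
  have hKle : |K x y| ≤ (4 * max C₀ 0 + max C₁ 0 * Real.log (4 * R ^ 2) ^ 2) / (2 * (p 0 - ρ₀)) ^ 8 * s ^ 8 /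
      Real.log Λ ^ 2 := by
    rw [le_div_iff₀ (by positivity)]
    linarith
  calc thetaTest 4 v (s • siteToE x) * v (s • siteToE y) * K x y
      ≤ |thetaTest 4 v (s • siteToE x) * v (s • siteToE y) * K x y| := le_abs_self _
    _ = |thetaTest 4 v (s • siteToE x)| * |v (s • siteToE y)| * |K x y| := by rw [abs_mul, abs_mul]
    _ ≤ _ := mul_le_mul_of_nonneg_left hKle (mul_nonneg (abs_nonneg _) (abs_nonneg _))

/-- Factorisation of the dominating double sum. [folklore] -/
theorem sum_sum_abs_mul_abs_mul (B : Finset (Fin 4 → ℤ)) (a b : (Fin 4 → ℤ) → ℝ) (c : ℝ) :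
    ∑ x ∈ B, ∑ y ∈ B, |a x| * |b y| * c = (∑ x ∈ B, |a x|) * (∑ y ∈ B, |b y|) * c := by
  rw [Finset.sum_mul_sum, Finset.sum_mul]
  refine Finset.sum_congr rfl fun x _ => ?_
  rw [Finset.sum_mul]

/-! ### The uniform smearing theorem -/

/-- **Smeared ceiling from pointwise kernel bounds, UNIFORM over `L¹`-normalised sources in a positive-time ball**
(the analysis half of line `pointwise-log-ceiling` in the currency of the repaired crux `RunningCouplingCeiling`,
stmt-QuantumFields-24275).  For all constants `C₀ C₁ C₂ n₀` and every ball `closedBall p ρ₀` with `ρ₀ < p₀` there is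
`C` such that: for every real Schwartz `v` with `tsupport v ⊆ closedBall p ρ₀` and `∫|v| ≤ 1` and every `Λ ≥ 2` there
are a unit threshold `t₀ > 0` and a torus threshold `Λ₆` with — for all `0 < t ≤ t₀`, all `L` with `Λ₆ ≤ t·L`, every
kernel `K` obeying `KernelBounds C₀ C₁ C₂ n₀ t L K`, and every `l ∈ [Λ, 2Λ]` —
`Σ_{x,y ∈ box L} θv(l t·x) v(l t·y) K x y ≤ C / log²Λ`.
(`C = 4(4C₀⁺ + C₁⁺ log²(4R²))/(2(p₀−ρ₀))⁸`, `R = ‖p‖ + |ρ₀| + 1`; `t₀` depends on `v` through the Riemann-sum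
thresholds of `|v|`, `|θv|`, and `Λ₆ = R`.) [folklore] -/
theorem uniform_smear (C₀ C₁ C₂ : ℝ) (n₀ : ℕ) (p : EuclideanSpace ℝ (Fin 4)) (ρ₀ : ℝ) (hp : ρ₀ < p 0) :
    ∃ C : ℝ, ∀ v : 𝓢(EuclideanSpace ℝ (Fin 4), ℝ),
      tsupport (v : EuclideanSpace ℝ (Fin 4) → ℝ) ⊆ closedBall p ρ₀ → (∫ y, |v y|) ≤ 1 →
      ∀ Λ : ℝ, 2 ≤ Λ → ∃ t₀ Λ₆ : ℝ, 0 < t₀ ∧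
        ∀ t : ℝ, 0 < t → t ≤ t₀ → ∀ L : ℕ, Λ₆ ≤ t * L →
          ∀ K : (Fin 4 → ℤ) → (Fin 4 → ℤ) → ℝ, KernelBounds C₀ C₁ C₂ n₀ t L K →
            ∀ l : ℝ, l ∈ Set.Icc Λ (2 * Λ) →
              ∑ x ∈ box 4 L, ∑ y ∈ box 4 L,
                (thetaTest 4 v) ((l * t) • siteToE x) * v ((l * t) • siteToE y) * K x y ≤
                  C / Real.log Λ ^ 2 := by
  -- constants: wall gap `δ`, support radius `R ≥ 1`, kernel constant `M`
  have hδ : 0 < p 0 - ρ₀ := by linarith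
  set R : ℝ := ‖p‖ + |ρ₀| + 1 with hR_def
  have hR1 : 1 ≤ R := by rw [hR_def]; linarith [norm_nonneg p, abs_nonneg ρ₀]
  have hρR : ‖p‖ + ρ₀ ≤ R := by rw [hR_def]; linarith [le_abs_self ρ₀]
  set M : ℝ := (4 * max C₀ 0 + max C₁ 0 * Real.log (4 * R ^ 2) ^ 2) / (2 * (p 0 - ρ₀)) ^ 8 with hM_def
  have hM : 0 ≤ M :=
    div_nonneg (add_nonneg (mul_nonneg (by norm_num) (le_max_right _ _))
      (mul_nonneg (le_max_right _ _) (sq_nonneg _))) (pow_nonneg (by linarith) 8)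
  refine ⟨4 * M, fun v hv hint Λ hΛ => ?_⟩
  -- supports of `v`, `θv` inside `closedBall 0 R`; Riemann thresholds for `|v|`, `|θv|`
  have hvR : tsupport (v : EuclideanSpace ℝ (Fin 4) → ℝ) ⊆ closedBall 0 R :=
    hv.trans (closedBall_subset_closedBall' (by rw [dist_zero_right]; linarith))
  have hθvR : tsupport (thetaTest 4 v : EuclideanSpace ℝ (Fin 4) → ℝ) ⊆ closedBall 0 R :=
    tsupport_thetaTest_subset_closedBall_zero hvR
  obtain ⟨s₁, hs₁, h₁⟩ := exists_latticeSum_abs_le v hvR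
  obtain ⟨s₂, hs₂, h₂⟩ := exists_latticeSum_abs_le (thetaTest 4 v) hθvR
  have hθint : (∫ y, |thetaTest 4 v y|) ≤ 1 := by rw [integral_abs_thetaTest]; exact hint
  have hΛ0 : 0 < Λ := by linarith
  -- thresholds: `s = l t ≤ 2Λ t₀ = min (min s₁ s₂) (δ/(n₀+1))`, tori `t·L ≥ R`
  set m : ℝ := min (min s₁ s₂) ((p 0 - ρ₀) / (n₀ + 1)) with hm_def
  have hm0 : 0 < m := lt_min (lt_min hs₁ hs₂) (div_pos hδ (by positivity))
  refine ⟨m / (2 * Λ), R, div_pos hm0 (by positivity), fun t ht htt₀ L hL K hK l hl => ?_⟩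
  obtain ⟨hl1, hl2⟩ := hl
  have hl0 : 0 < l := by linarith
  have hs : 0 < l * t := mul_pos hl0 ht
  have hsm : l * t ≤ m := by
    calc l * t ≤ (2 * Λ) * (m / (2 * Λ)) := mul_le_mul hl2 htt₀ ht.le (by positivity)
      _ = m := by field_simp
  have hss₁ : l * t ≤ s₁ := hsm.trans ((min_le_left _ _).trans (min_le_left _ _))
  have hss₂ : l * t ≤ s₂ := hsm.trans ((min_le_left _ _).trans (min_le_right _ _))
  have hsδ : l * t * ((n₀ : ℝ) + 1) ≤ p 0 - ρ₀ := by
    have h := hsm.trans (min_le_right _ _)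
    rwa [le_div_iff₀ (by positivity)] at h
  have hts : t ≤ l * t := by
    calc t = 1 * t := (one_mul t).symm
      _ ≤ l * t := mul_le_mul_of_nonneg_right (by linarith) ht.le
  have hRsL : R ≤ l * t * L := hL.trans (mul_le_mul_of_nonneg_right hts (Nat.cast_nonneg L))
  have h2RsL : 2 * R ≤ l * t * L := by
    calc 2 * R ≤ 2 * (t * L) := by linarith
      _ = (2 * t) * L := by ring
      _ ≤ l * t * L := mul_le_mul_of_nonneg_right (mul_le_mul_of_nonneg_right (by linarith) ht.le)
          (Nat.cast_nonneg L)
  -- per-pair bound, summed and factorised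
  have hsum := Finset.sum_le_sum fun x hx => Finset.sum_le_sum fun y hy =>
    pair_bound hv hK hR1 hρR hΛ hl1 ht rfl hsδ h2RsL hx hy
  have hA := h₂ (l * t) hs hss₂ L hRsL
  have hB := h₁ (l * t) hs hss₁ L hRsL
  have hA2 : (l * t) ^ 4 * ∑ x ∈ box 4 L, |thetaTest 4 v ((l * t) • siteToE x)| ≤ 2 := by linarith
  have hB2 : (l * t) ^ 4 * ∑ y ∈ box 4 L, |v ((l * t) • siteToE y)| ≤ 2 := by linarith
  have hB0 : 0 ≤ (l * t) ^ 4 * ∑ y ∈ box 4 L, |v ((l * t) • siteToE y)| :=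
    mul_nonneg (pow_nonneg hs.le 4) (Finset.sum_nonneg fun y _ => abs_nonneg _)
  have hlog2 : 0 < Real.log Λ ^ 2 := pow_pos (Real.log_pos (by linarith)) 2
  refine hsum.trans ?_
  rw [sum_sum_abs_mul_abs_mul]
  calc (∑ x ∈ box 4 L, |thetaTest 4 v ((l * t) • siteToE x)|) * (∑ y ∈ box 4 L, |v ((l * t) • siteToE y)|) *
        (M * (l * t) ^ 8 / Real.log Λ ^ 2)
      = (M / Real.log Λ ^ 2) * (((l * t) ^ 4 * ∑ x ∈ box 4 L, |thetaTest 4 v ((l * t) • siteToE x)|) *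
          ((l * t) ^ 4 * ∑ y ∈ box 4 L, |v ((l * t) • siteToE y)|)) := by ring
    _ ≤ (M / Real.log Λ ^ 2) * (2 * 2) := by
        refine mul_le_mul_of_nonneg_left ?_ (div_nonneg hM hlog2.le)
        exact mul_le_mul hA2 hB2 hB0 (by norm_num)
    _ = 4 * M / Real.log Λ ^ 2 := by ring

end Summit.QuantumFields.YangMills.Cruxes.RunningCouplingCeiling.Pointwise

end
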